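import Summits.ResolutionOfSingularities.ResolutionOfSingularities.Theorems.CurveCutCells
import Summits.ResolutionOfSingularities.ResolutionOfSingularities.Theorems.WeightedInvariantOrderSemicontinuousSmooth
import Literature.AlgebraicGeometry.Resolution.QuasiExcellentSchemes
import Literature.AlgebraicGeometry.Resolution.ExcellentRingsFieldProofs
import Literature.AlgebraicGeometry.Resolution.StalkIdealLemmas
import HarnessLib

/-!
# IsoCompanionCutKernels — decomp-res node «IsoCompanionCut» (lens-4 g36, critic row 203 CLEARED (NP-C′) DECIDED +1
· MAP 0), tree file 1/2 of the node

Content VERBATIM from the decomp-res lens-4 g36 node `HOME/decomp-res-lens-4/g36/IsoCompanionCut.lean` (pin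
38bd0157; no carry, imports the landed tree only; namespace `…Theorems.HugValuationCut`); HOME =
run/shared/lean/pub/decomp-res; critic CRITIC-LEDGER row 203 CLEARED (NP-C′) DECIDED +1 · MAP 0; landing orders
INBOX :1298 (09:35:11Z) + lens notes :1294 / :1296 — provenance, critic text and the lens header in full in the
SECOND file of the node, `IsoCompanionCutCells` (so that FILE A of the landing form stays one tree file under the
400-line cap).  `--kind proof --supports stmt-ResolutionOfSingularities-28338`.

## This file

§115 (g36 · NEW · LETTER + TOOL) THE ISOLATED-COMPANION LETTER AND THE RE-ROOTED COMPANION TOWER (`section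
Companion`): the companion marked chain `companionMarked T m a H j` (the BGMW chain of `(H, ∅, a)` along `T`'s own
blow-ups and centres: `companionMarked_zero/_succ/_mult/_ideal/_boundary_zero`, `mem_support_companionMarked_iff`),
weight-`a` order PERSISTENCE `idealOrder_companionMarked_pt` (from g32 `FactorAt.forcing` / `principal_facIter`),
`pt_mem_support_companionMarked`, `isPrincipal_stalkIdeal_companionMarked_pt`; THE LETTER (I∞)
**`IsolatedCompanionTower T`** (+ `not_isolatedCompanionTower_iff`); THE TOOL **`towerOfCompanion T m a H hI :
ForcedTower`** (a complete structure term; field lemmas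
`towerOfCompanion_St/_D/_pt/_centre/_π/_D_zero/_boundary_zero/_isBase/_isLocallyNoetherian/_threefoldTower/_principalRoot`),
the semicontinuity-open root `isOpen_setOf_idealOrder_le` / `companionRootOpens` (`mem_companionRootOpens_iff`,
`pt_mem_companionRootOpens`), `isPrincipal_stalkIdeal_comap`, and the RESTRICTED companion tower
**`companionTower`** (g34 `towerRestrict` to `U₀ = {ord H ≤ a}`;
`companionTower_isBase/_isDatum/_boundary/_principalRoot/_threefoldTower`); §116 (NEW · LAW, MODULO THE SURFACE
PORT; `section CompanionLaw`): (α′) the all-characteristic principal rd-3 column re-assembled BY NAME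
`noTower_principalThreefold_of_port (h640) (hn : 2 ≤ n)` (+ the documentation corollary
`noTowerWild_principalThreefold_of_port'`), (β′) THE LAW **`noTower_threefold_isolatedCompanion_of_port`** (every
`p`, field, class `P`, weight `n`) with its wild name `noTowerWild_threefold_isolatedCompanion_of_port`, and the
typed reading of ¬(I∞) **`recurrent_nonIsolation`** (proved from the letters).

[WRITER NOTE (decomp-res writer g13): file split only, at the node's own `══ FILE` markers (tree files ≤ 400 lines);
namespace, sections, section variables and every declaration exactly as in the lens (the node's HOME-only
dupNamespace-linter line is dropped — the library sets it; `noncomputable section` and the namespace-level `open`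
lines of the node are replayed in both files).]

(Sources: CossartJannsenSaito2020 Thm. 6.40, Def. 6.38–6.39, Ch. 8; CossartPiltant2008 Prop. 4.2, Prop. 4.4;
Kollar2007 3.58–3.60; Hironaka1964 Ch. III; Giraud1975; Hauser2010Kangaroo; HauserPerlega2019 §2; Matsumura1987
Thms. 14.3, 32.4; StacksProject 07QW / 07P7 / 0C23.)
-/

noncomputable section

open CategoryTheory AlgebraicGeometry IsLocalRing TopologicalSpace
open Literature.AlgebraicGeometry.Resolution
open Summit.ResolutionOfSingularities.ResolutionOfSingularities.Theorems
open WeakOrderReduction ForcedTowerClasses DivergentTowerClasses MonomialTowerClasses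
open HugDimensionClasses HugDimensionKernels SurfaceShadowClasses SurfaceShadowKernels
open NearPointCut (SingularClass)
open Scheme.IdealSheafData (vanishingIdeal)
open scoped BigOperators

namespace Summit.ResolutionOfSingularities.ResolutionOfSingularities.Theorems.HugValuationCut

section Companion

variable {k : Type} [Field k]

/-! ## ══ FILE A `Theorems/IsoCompanionCutKernels.lean` (§115–§116; cone-free) ══ -/

/-! ## §115 (g36 · NEW · LETTER + TOOL) THE ISOLATED-COMPANION LETTER AND THE RE-ROOTED COMPANION TOWER

The structural move of this generation (NEXT-g36 §1 (a)+(b), critic rows 199 / 201a).  An occult divisorial tower has, at some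
stage `m`, a PRINCIPAL factor of its marked stalk, `𝓘_{x_m} = (h)·K_{x_m}` with `ord h = a ≥ 2` (tree `occult_letters`), and the
factorisation PERSISTS along the tower with the same weights (`FactorAt.forcing`: `𝓘_{x_{m+j}} = (h_j)·K_j`, `h_j` = the
weight-`a` controlled transform chain `facIter T m a H j`, principal by `FactorAt.principal_facIter`, `ord_{x_{m+j}} h_j = a`).
THE COMPANION MARKED CHAIN `companionMarked T m a H j := ` the BGMW chain of the marked ideal `(H, ∅, a)` of stage `m` along `T`'s
OWN blow-ups and centres (ideal `facIter T m a H j`, multiplicity `a`, boundary the exceptional divisors accumulated SINCE stage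
`m` — a SYNTHETIC boundary: the companion forgets `T`'s boundary; no field of `ForcedTower` consults the boundary except
`transform_eq`, which holds for the chain by `rfl`, and the column reads the ROOT boundary only, as `= []`).
THE LETTER (I∞) `IsolatedCompanionTower T`: for some such principal factor the marked point `x_{m+j}` is ISOLATED in the
companion support `Top(h_j, a) = {ord h_j ≥ a}` at EVERY `j ≥ 0` («the companion hypersurface has isolated
weight-`a` locus along
the tower from its birth stage on»; re-rooting later is the same letter with a larger `m`).
THE TOOL `towerOfCompanion T m a H hI : ForcedTower` — under (I∞) the chain `(X_{m+j}, (h_j, E^{syn}_j, a), x_{m+j}, C_{m+j},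
π_{m+j})` IS a forced tower (every field is the corresponding field of `T` shifted by `m`, `isolated := hI`,
`transform_eq := rfl`); its root is NOT a datum of the class globally (`ord_y H` may exceed `a` away from `x_m`), so it is
RESTRICTED (g34 `towerRestrict`) to the open `U₀ = {y | ord_y H ≤ a} ∋ x_m` — open by the upper semicontinuity of the order on
the Noetherian regular EXCELLENT stage `X_m` (tree `OrderSemicontinuity.isClosed_setOf_le_idealOrder_general`; excellence from
`Scheme.isExcellent_of_locallyOfFiniteType Stacks07QW_field_holds` over the base `toRoot T m ≫ g`, `tower_isBase`).  The
restricted companion tower `companionTower` has: base `U₀.ι ≫ toRoot T m ≫ g` of the class (`towerRestrict_isBase`), `IsDatum a`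
at the root, root boundary `[]`, PRINCIPAL ROOT (the stalk of `H|U₀` at `x_m` is the image of the principal stalk of `H` under
the stalk isomorphism), and it is THREEFOLD if `T` is (same local rings, `towerRestrict_threefoldTower`). -/

/-- **the companion marked chain** of a factor `H` of weight `a` at stage `m`: `(H, ∅, a)` and its successive BGMW transforms
along `T`'s blow-ups and centres (SYNTHETIC empty root boundary). -/
def companionMarked (T : ForcedTower) (m a : ℕ) (H : (T.St m).IdealSheafData) : (j : ℕ) → MarkedIdeal (T.St (m + j))
  | 0 => ⟨H, [], a⟩
  | j + 1 => (companionMarked T m a H j).transform (T.π (m + j)) (T.centre (m + j))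

/-- unfolding. [folklore] -/
theorem companionMarked_zero (T : ForcedTower) (m a : ℕ) (H : (T.St m).IdealSheafData) :
    companionMarked T m a H 0 = ⟨H, [], a⟩ := rfl

/-- unfolding. [folklore] -/
theorem companionMarked_succ (T : ForcedTower) (m a : ℕ) (H : (T.St m).IdealSheafData) (j : ℕ) :
    companionMarked T m a H (j + 1) = (companionMarked T m a H j).transform (T.π (m + j)) (T.centre (m + j)) := rfl

/-- the companion chain has multiplicity `a` throughout. [folklore] -/
theorem companionMarked_mult (T : ForcedTower) (m a : ℕ) (H : (T.St m).IdealSheafData) :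
    ∀ j, (companionMarked T m a H j).mult = a
  | 0 => rfl
  | j + 1 => by rw [companionMarked_succ, MarkedIdeal.transform_mult, companionMarked_mult T m a H j]

/-- **the ideals of the companion chain are the factor chain** `facIter T m a H` of FactorCut (§99). [folklore] -/
theorem companionMarked_ideal (T : ForcedTower) (m a : ℕ) (H : (T.St m).IdealSheafData) :
    ∀ j, (companionMarked T m a H j).ideal = facIter T m a H j
  | 0 => rfl
  | j + 1 => by
    rw [companionMarked_succ, MarkedIdeal.transform_ideal, companionMarked_mult, companionMarked_ideal T m a H j,
      facIter_succ]

/-- the ROOT boundary of the companion chain is empty (synthetic). [folklore] -/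
theorem companionMarked_boundary_zero (T : ForcedTower) (m a : ℕ) (H : (T.St m).IdealSheafData) :
    (companionMarked T m a H 0).boundary = [] := rfl

/-- **the companion support is the weight-`a` locus of the factor chain**: `y ∈ Top(h_j, a) ⟺ ord_y h_j ≥ a`. [folklore] -/
theorem mem_support_companionMarked_iff (T : ForcedTower) (m a : ℕ) (H : (T.St m).IdealSheafData) (j : ℕ)
    (y : T.St (m + j)) : y ∈ (companionMarked T m a H j).support ↔ (a : ℕ∞) ≤ idealOrder (facIter T m a H j) y := by
  show ((companionMarked T m a H j).mult : ℕ∞) ≤ idealOrder (companionMarked T m a H j).ideal y ↔ _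
  rw [companionMarked_mult, companionMarked_ideal]

/-- **PERSISTENCE OF THE WEIGHT (from the letters, kernel)**: along the tower the factor chain has order EXACTLY `a` at the
marked points (`FactorAt.forcing`). [folklore] -/
theorem idealOrder_companionMarked_pt (T : ForcedTower) (g : T.St 0 ⟶ Spec (.of k)) (hB : IsBase (T.St 0) g) {n : ℕ}
    (hD : IsDatum n (T.D 0)) {m a b : ℕ} {H K : (T.St m).IdealSheafData} (hF : FactorAt T m a b H K) (j : ℕ) :
    idealOrder (companionMarked T m a H j).ideal (T.pt (m + j)) = a := by
  rw [companionMarked_ideal]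
  exact (hF.forcing T g hB hD j).2.1

/-- hence the marked points lie in the companion support at every stage. [folklore] -/
theorem pt_mem_support_companionMarked (T : ForcedTower) (g : T.St 0 ⟶ Spec (.of k)) (hB : IsBase (T.St 0) g) {n : ℕ}
    (hD : IsDatum n (T.D 0)) {m a b : ℕ} {H K : (T.St m).IdealSheafData} (hF : FactorAt T m a b H K) (j : ℕ) :
    T.pt (m + j) ∈ (companionMarked T m a H j).support :=
  (mem_support_companionMarked_iff T m a H j _).mpr (hF.forcing T g hB hD j).2.1.ge

/-- the principal factor stays principal along the companion chain (tree `FactorAt.principal_facIter`). [folklore] -/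
theorem isPrincipal_stalkIdeal_companionMarked_pt (T : ForcedTower) (g : T.St 0 ⟶ Spec (.of k)) (hB : IsBase (T.St 0) g)
    {n : ℕ} (hD : IsDatum n (T.D 0)) {m a b : ℕ} {H K : (T.St m).IdealSheafData} (hF : FactorAt T m a b H K)
    (hP : (stalkIdeal H (T.pt m)).IsPrincipal) (j : ℕ) :
    (stalkIdeal (companionMarked T m a H j).ideal (T.pt (m + j))).IsPrincipal := by
  rw [companionMarked_ideal]
  exact (hF.principal_facIter T g hB hD hP j).1

/-- **LETTER (I∞) «ISOLATED COMPANION» (g36 · structural, by mechanism)**: some PRINCIPAL factor `h` of weight `a ≥ 2` of the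
marked stalk at some stage `m` (`𝓘_{x_m} = (h)·K_{x_m}`) has its marked point ISOLATED in its OWN weight-`a` locus
`Top(h_j, a)` at EVERY later stage — the companion hypersurface roots a forced tower of its own. -/
def IsolatedCompanionTower (T : ForcedTower) : Prop :=
  ∃ (m a b : ℕ) (H K : (T.St m).IdealSheafData), FactorAt T m a b H K ∧ 2 ≤ a ∧ (stalkIdeal H (T.pt m)).IsPrincipal ∧
    ∀ j, IsIsolatedIn (companionMarked T m a H j).support (T.pt (m + j))

/-- pure logic: the NEGATION of (I∞) — every principal factor of weight `≥ 2` has a NON-ISOLATED stage. [folklore] -/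
theorem not_isolatedCompanionTower_iff (T : ForcedTower) :
    ¬ IsolatedCompanionTower T ↔
      ∀ (m a b : ℕ) (H K : (T.St m).IdealSheafData), FactorAt T m a b H K → 2 ≤ a → (stalkIdeal H (T.pt m)).IsPrincipal →
        ∃ j, ¬ IsIsolatedIn (companionMarked T m a H j).support (T.pt (m + j)) := by
  simp only [IsolatedCompanionTower, not_exists, not_and, not_forall]

/-- **THE TOOL: THE RE-ROOTED COMPANION TOWER** (a complete `ForcedTower` term; external inputs `T, m, a, H` and the isolation
letter `hI` only).  Stages `X_{m+j}`, marked ideals the companion chain, marked points / centres / blow-ups those of `T`;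
`transform_eq` by `rfl`; the root boundary is the synthetic `[]`. -/
def towerOfCompanion (T : ForcedTower) (m a : ℕ) (H : (T.St m).IdealSheafData)
    (hI : ∀ j, IsIsolatedIn (companionMarked T m a H j).support (T.pt (m + j))) : ForcedTower where
  St j := T.St (m + j)
  D j := companionMarked T m a H j
  pt j := T.pt (m + j)
  centre j := T.centre (m + j)
  π j := T.π (m + j)
  isolated := hI
  isClosed_pt j := T.isClosed_pt (m + j)
  centre_support j := T.centre_support (m + j)
  centre_regular j := T.centre_regular (m + j)
  isBlowup j := T.isBlowup (m + j)
  transform_eq _ := rfl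
  pt_map j := T.pt_map (m + j)

variable (T : ForcedTower) (m a : ℕ) (H : (T.St m).IdealSheafData)
  (hI : ∀ j, IsIsolatedIn (companionMarked T m a H j).support (T.pt (m + j)))

/-- unfolding. [folklore] -/
theorem towerOfCompanion_St (j : ℕ) : (towerOfCompanion T m a H hI).St j = T.St (m + j) := rfl

/-- unfolding. [folklore] -/
theorem towerOfCompanion_D (j : ℕ) : (towerOfCompanion T m a H hI).D j = companionMarked T m a H j := rfl

/-- unfolding. [folklore] -/
theorem towerOfCompanion_pt (j : ℕ) : (towerOfCompanion T m a H hI).pt j = T.pt (m + j) := rfl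

/-- unfolding. [folklore] -/
theorem towerOfCompanion_centre (j : ℕ) : (towerOfCompanion T m a H hI).centre j = T.centre (m + j) := rfl

/-- unfolding. [folklore] -/
theorem towerOfCompanion_π (j : ℕ) : (towerOfCompanion T m a H hI).π j = T.π (m + j) := rfl

/-- the root marked ideal of the companion tower is `(H, ∅, a)`. [folklore] -/
theorem towerOfCompanion_D_zero : (towerOfCompanion T m a H hI).D 0 = ⟨H, [], a⟩ := rfl

/-- the root boundary of the companion tower is empty (synthetic). [folklore] -/
theorem towerOfCompanion_boundary_zero : ((towerOfCompanion T m a H hI).D 0).boundary = [] := rfl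

/-- **the root stage `X_m` of the companion tower is of the base class over `k`** (base `toRoot T m ≫ g`, tree `tower_isBase`).
[folklore] -/
theorem towerOfCompanion_isBase (g : T.St 0 ⟶ Spec (.of k)) (hB : IsBase (T.St 0) g) :
    IsBase ((towerOfCompanion T m a H hI).St 0) (toRoot T m ≫ g) :=
  tower_isBase T g hB m

/-- the stages of the companion tower are locally Noetherian. [folklore] -/
theorem towerOfCompanion_isLocallyNoetherian (g : T.St 0 ⟶ Spec (.of k)) (hB : IsBase (T.St 0) g) :
    ∀ j, IsLocallyNoetherian ((towerOfCompanion T m a H hI).St j) :=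
  fun j => (tower_isLocallyNoetherian_isRegular T g hB (m + j)).1

/-- the companion tower is THREEFOLD if `T` is (same local rings). [folklore] -/
theorem towerOfCompanion_threefoldTower (h3 : ThreefoldTower T) : ThreefoldTower (towerOfCompanion T m a H hI) :=
  fun j => h3 (m + j)

/-- the companion tower has PRINCIPAL ROOT if the factor is principal. [folklore] -/
theorem towerOfCompanion_principalRoot (hP : (stalkIdeal H (T.pt m)).IsPrincipal) :
    PrincipalRoot (towerOfCompanion T m a H hI) :=
  hP

/-- **UPPER SEMICONTINUITY OF THE ORDER ON A TOWER STAGE**: `{y ∈ X_m | ord_y F ≤ a}` is OPEN (the stage is Noetherian,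
regular and EXCELLENT — locally of finite type over the field; tree `isClosed_setOf_le_idealOrder_general`).
(Sources: CossartPiltant2008, Prop. 4.2; StacksProject, Tag 07QW.) -/
theorem isOpen_setOf_idealOrder_le (g : T.St 0 ⟶ Spec (.of k)) (hB : IsBase (T.St 0) g) (F : (T.St m).IdealSheafData) :
    IsOpen {y : T.St m | idealOrder F y ≤ (a : ℕ∞)} := by
  haveI : IsNoetherian (T.St m) := tower_isNoetherian T g hB m
  haveI : LocallyOfFiniteType (toRoot T m ≫ g) := (tower_isBase T g hB m).locallyOfFiniteType
  have hreg : Scheme.IsRegular (T.St m) := (tower_isBase T g hB m).isRegular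
  have hexc : Scheme.IsExcellent (T.St m) :=
    Scheme.isExcellent_of_locallyOfFiniteType Stacks07QW_field_holds (toRoot T m ≫ g)
  have hcl := OrderSemicontinuity.isClosed_setOf_le_idealOrder_general hreg hexc F ((a : ℕ∞) + 1)
  convert hcl.isOpen_compl using 1
  ext y
  simp only [Set.mem_setOf_eq, Set.mem_compl_iff, not_le]
  exact ENat.lt_coe_add_one_iff.symm

/-- **the ROOT OPEN of the companion**: `U₀ = {y ∈ X_m | ord_y H ≤ a}`, an open of the root stage of the companion tower. -/
def companionRootOpens (g : T.St 0 ⟶ Spec (.of k)) (hB : IsBase (T.St 0) g) : ((towerOfCompanion T m a H hI).St 0).Opens :=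
  ⟨{y : T.St m | idealOrder H y ≤ (a : ℕ∞)}, isOpen_setOf_idealOrder_le T m a g hB H⟩

/-- membership in the root open. [folklore] -/
theorem mem_companionRootOpens_iff (g : T.St 0 ⟶ Spec (.of k)) (hB : IsBase (T.St 0) g) (y : T.St m) :
    y ∈ companionRootOpens T m a H hI g hB ↔ idealOrder H y ≤ (a : ℕ∞) := Iff.rfl

/-- the marked point `x_m` lies in the root open (its order is exactly `a`). [folklore] -/
theorem pt_mem_companionRootOpens (g : T.St 0 ⟶ Spec (.of k)) (hB : IsBase (T.St 0) g) {b : ℕ}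
    {K : (T.St m).IdealSheafData} (hF : FactorAt T m a b H K) :
    (towerOfCompanion T m a H hI).pt 0 ∈ companionRootOpens T m a H hI g hB :=
  (mem_companionRootOpens_iff T m a H hI g hB (T.pt m)).mpr hF.2.1.le

/-- a principal stalk pulls back to a principal stalk (any morphism: the image of a principal ideal is principal; tree
`stalkIdeal_comap_eq_map_stalkMap`). [folklore] -/
theorem isPrincipal_stalkIdeal_comap {V X : Scheme.{0}} (f : V ⟶ X) (I : X.IdealSheafData) (v : V)
    (h : (stalkIdeal I (f v)).IsPrincipal) : (stalkIdeal (I.comap f) v).IsPrincipal := by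
  obtain ⟨u, hu⟩ := h
  refine ⟨⟨(f.stalkMap v).hom u, ?_⟩⟩
  rw [stalkIdeal_comap_eq_map_stalkMap, hu, Ideal.submodule_span_eq, Ideal.map_span, Set.image_singleton,
    Ideal.submodule_span_eq]

/-- **THE RESTRICTED COMPANION TOWER** `companionTower` := the companion tower restricted (g34 `towerRestrict`) to the root open
`U₀ = {ord H ≤ a}`: a forced tower OF THE CLASS at weight `a` (below). -/
def companionTower (g : T.St 0 ⟶ Spec (.of k)) (hB : IsBase (T.St 0) g)
    (h0 : (towerOfCompanion T m a H hI).pt 0 ∈ companionRootOpens T m a H hI g hB) : ForcedTower :=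
  towerRestrict (towerOfCompanion T m a H hI) (towerOfCompanion_isLocallyNoetherian T m a H hI g hB)
    (companionRootOpens T m a H hI g hB) h0

variable (g : T.St 0 ⟶ Spec (.of k)) (hB : IsBase (T.St 0) g)
  (h0 : (towerOfCompanion T m a H hI).pt 0 ∈ companionRootOpens T m a H hI g hB)

/-- **ROOT LETTER `IsBase`** of the restricted companion tower: base `U₀ ↪ X_m → X_0 → Spec k` (`towerRestrict_isBase` ∘
`tower_isBase`). [folklore] -/
theorem companionTower_isBase :
    IsBase ((companionTower T m a H hI g hB h0).St 0) ((companionRootOpens T m a H hI g hB).ι ≫ toRoot T m ≫ g) :=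
  towerRestrict_isBase (towerOfCompanion T m a H hI) (towerOfCompanion_isLocallyNoetherian T m a H hI g hB)
    (companionRootOpens T m a H hI g hB) h0 (toRoot T m ≫ g) (towerOfCompanion_isBase T m a H hI g hB)

/-- **ROOT LETTER `IsDatum a`** of the restricted companion tower: multiplicity `a`, and `ord ≤ a` EVERYWHERE on `U₀` (by the
choice of `U₀`; `idealOrder_comap_of_isOpenImmersion`). [folklore] -/
theorem companionTower_isDatum : IsDatum a ((companionTower T m a H hI g hB h0).D 0) := by
  refine ⟨rfl, fun y => ?_⟩
  show idealOrder ((((towerOfCompanion T m a H hI).D 0).ideal).comap (companionRootOpens T m a H hI g hB).ι) y ≤ _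
  rw [idealOrder_comap_of_isOpenImmersion]
  exact y.2

/-- **ROOT LETTER «empty boundary»** of the restricted companion tower (synthetic, by construction). [folklore] -/
theorem companionTower_boundary : ((companionTower T m a H hI g hB h0).D 0).boundary = [] :=
  towerRestrict_boundary _ _ _ _ rfl

/-- **LETTER `PrincipalRoot`** of the restricted companion tower, from the principality of the factor (stalk isomorphism of the
open immersion). [folklore] -/
theorem companionTower_principalRoot (hP : (stalkIdeal H (T.pt m)).IsPrincipal) :
    PrincipalRoot (companionTower T m a H hI g hB h0) :=
  isPrincipal_stalkIdeal_comap (companionRootOpens T m a H hI g hB).ι H _ hP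

/-- **LETTER `ThreefoldTower`** of the restricted companion tower (same local rings as `T` from stage `m`). [folklore] -/
theorem companionTower_threefoldTower (h3 : ThreefoldTower T) : ThreefoldTower (companionTower T m a H hI g hB h0) :=
  towerRestrict_threefoldTower _ _ _ _ (towerOfCompanion_threefoldTower T m a H hI h3)

end Companion

section CompanionLaw

variable {k : Type} [Field k]

/-! ## §116 (g36 · NEW · LAW, MODULO THE SURFACE PORT) NO FORCED THREEFOLD TOWER HAS AN ISOLATED PRINCIPAL COMPANION

(α′) THE ALL-CHARACTERISTIC PRINCIPAL RING-DIMENSION-3 COLUMN, re-assembled BY NAME from its two constituents in the tree: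
on the PlaneCone branch the surface column `noTower_surfaceColumn_of_port h640` (SurfacePort §89; the PORT `SurfaceChainPort` =
CJS2020 Thm 6.40 on the Literature side, `surfaceChainPort_iff_CJS2020`), on the other branch the kernel law
`noTower_threefold_not_planeCone` (TauChainLaw2, port-free) — for EVERY `p` and every weight `n ≥ 2` (the tree's wild column
`noTowerWild_principalThreefold_of_port` of TauChainCutCells is the `p ∣ n` specialisation; `p ∣ a` is NOT available for a
companion weight: `FactorAt.dvd_of_occult` needs a separable-residue point).  (β′) THE LAW: a threefold tower with an isolated
principal companion roots, by §115, a forced tower OF THE CLASS at weight `a ≥ 2` with principal root and ring dimension 3 —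
which the column forbids.  Currency: DECIDED-MOD-PORT(CJS 6.40) — the column's own; no other hypothesis. -/

/-- **(α′) THE PRINCIPAL RING-DIMENSION-3 COLUMN, ALL CHARACTERISTICS, EVERY CLASS `P`, every weight `n ≥ 2`** — modulo the
surface port only (pure re-assembly of `noTower_surfaceColumn_of_port` and `noTower_threefold_not_planeCone`).
(Sources: CossartJannsenSaito2020, Thm. 6.40; CossartPiltant2008, Prop. 4.2.) -/
theorem noTower_principalThreefold_of_port (h640 : SurfaceChainPort) {n : ℕ} (hn : 2 ≤ n) (P : ForcedTower → Prop) :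
    NoTower n fun T => P T ∧ (PrincipalRoot T ∧ ThreefoldTower T) := by
  intro p hp K _ _ T g hB hD hE hT
  obtain ⟨hP, hprin, h3⟩ := hT
  by_cases hcone : PlaneConeTower n T
  · exact noTower_surfaceColumn_of_port h640 hn P p hp K T g hB hD hE ⟨hP, hprin, h3, Or.inl hcone⟩
  · exact noTower_threefold_not_planeCone (by omega) P p hp K T g hB hD hE ⟨hP, h3, hcone⟩

/-- the tree's WILD column at weights `n ≥ 2` is the `p ∣ n` specialisation of (α′) (documentation of the adaptation; the tree's
own `noTowerWild_principalThreefold_of_port` covers `n ≥ 1`). [folklore] -/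
theorem noTowerWild_principalThreefold_of_port' (h640 : SurfaceChainPort) {n : ℕ} (hn : 2 ≤ n) (P : ForcedTower → Prop) :
    NoTowerWild n fun T => P T ∧ (PrincipalRoot T ∧ ThreefoldTower T) :=
  fun p hp _ K _ _ T g hB hD hE hT => noTower_principalThreefold_of_port h640 hn P p hp K T g hB hD hE hT

/-- **THE LAW OF g36 (β′): NO FORCED THREEFOLD TOWER HAS AN ISOLATED PRINCIPAL COMPANION** — every `p`, every field, EVERY class
`P`, every weight `n`, MODULO THE SURFACE PORT: the restricted re-rooted companion tower `companionTower` is a forced tower of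
the class at weight `a ≥ 2` with principal root and ring dimension 3, forbidden by the column (α′).
(Sources: CossartJannsenSaito2020, Thm. 6.40; CossartPiltant2008, Prop. 4.2; Kollar2007, 3.58–3.60.) -/
theorem noTower_threefold_isolatedCompanion_of_port (h640 : SurfaceChainPort) (n : ℕ) (P : ForcedTower → Prop) :
    NoTower n fun T => P T ∧ ThreefoldTower T ∧ IsolatedCompanionTower T := by
  intro p hp K _ _ T g hB hD hE hT
  obtain ⟨-, h3, m, a, b, H, K', hF, ha, hHprin, hI⟩ := hT
  have h0 : (towerOfCompanion T m a H hI).pt 0 ∈ companionRootOpens T m a H hI g hB :=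
    pt_mem_companionRootOpens T m a H hI g hB hF
  exact noTower_principalThreefold_of_port h640 ha (fun _ => True) p hp K (companionTower T m a H hI g hB h0)
    ((companionRootOpens T m a H hI g hB).ι ≫ toRoot T m ≫ g) (companionTower_isBase T m a H hI g hB h0)
    (companionTower_isDatum T m a H hI g hB h0) (companionTower_boundary T m a H hI g hB h0)
    ⟨trivial, companionTower_principalRoot T m a H hI g hB h0 hHprin, companionTower_threefoldTower T m a H hI g hB h0 h3⟩

/-- the same law on the wild column (specialisation). [folklore] -/
theorem noTowerWild_threefold_isolatedCompanion_of_port (h640 : SurfaceChainPort) (n : ℕ) (P : ForcedTower → Prop) :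
    NoTowerWild n fun T => P T ∧ ThreefoldTower T ∧ IsolatedCompanionTower T :=
  fun p hp _ K _ _ T g hB hD hE hT => noTower_threefold_isolatedCompanion_of_port h640 n P p hp K T g hB hD hE hT

/-- **THE RESIDUAL'S MECHANISM, PROVED FROM THE LETTERS (kernel): RECURRENT NON-ISOLATION.**  If a tower has NO isolated
companion (`¬ (I∞)`), then every principal factor of weight `a ≥ 2` at stage `m`, RE-ROOTED AT ANY LATER STAGE `m +
j₀` (where it
is again a principal factor of weight `a`: `FactorAt.forcing`, `FactorAt.principal_facIter`), has a later stage at which the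
marked point is NOT ISOLATED in the weight-`a` locus of its companion chain — non-isolation recurs infinitely often.  (At the
desk, an infinitely near non-isolated stage of an otherwise point-forced tower is a RULED BIRTH — a new `a`-fold curve of the
companion surface born inside the newest exceptional divisor — or a followed singular curve germ: the
RULED-RECURRENT core (RR).)
[folklore] -/
theorem recurrent_nonIsolation (T : ForcedTower) (g : T.St 0 ⟶ Spec (.of k)) (hB : IsBase (T.St 0) g) {n : ℕ}
    (hD : IsDatum n (T.D 0)) (hrec : ¬ IsolatedCompanionTower T) {m a b : ℕ} {H K : (T.St m).IdealSheafData}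
    (hF : FactorAt T m a b H K) (ha : 2 ≤ a) (hP : (stalkIdeal H (T.pt m)).IsPrincipal) (j₀ : ℕ) :
    ∃ j, ¬ IsIsolatedIn (companionMarked T (m + j₀) a (facIter T m a H j₀) j).support (T.pt (m + j₀ + j)) :=
  (not_isolatedCompanionTower_iff T).mp hrec (m + j₀) a b (facIter T m a H j₀) (facIter T m b K j₀) (hF.forcing T g hB hD j₀)
    ha (hF.principal_facIter T g hB hD hP j₀).1

end CompanionLaw

end Summit.ResolutionOfSingularities.ResolutionOfSingularities.Theorems.HugValuationCut
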